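import Literature.Computability.Cryptography.ChenQuantumLWEBoxWrapBound

/-!
# Digit observers of the Step-9 register, III: uniform marginals of the parity-check box (T23)

REPRODUCTION / ANALYSIS OF A CLAIMED RESULT UNDER ADJUDICATION (withdrawn): Yilei Chen, *Quantum
Algorithms for Lattice Problems*, IACR ePrint 2024/555, version of 2024-04-18 [ChenQuantumLattice2024]
(the version carrying the author's note that Step 9 contains a bug), the LWE instance as the `q`-ary
lattice `L_q^⊥(A)`, `A = [2p₁t | Uᵀ | I_m] ∈ ℤ_q^{m×n}` (§3.2 pp. 16–18, restated at the head of §3.3,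
p. 18), the secret `b = [−1, 2p₁sᵀ, 2p₁eᵀ]ᵀ ∈ L_q^⊥(A)` of eq. (12) (p. 17), and Step 9 (§3.5.9,
pp. 34–38).  Bundle `papers/QuantumAdvantage/lwe-quantum-autopsy/`, Part 2 (`REPAIR-CENSUS.md` §31,
theorem **T23**, census row G7), sequel of `ChenQuantumLWEBoxWrapBound.lean` (T21), whose ONE remaining
counting hypothesis — UNIFORM COORDINATE MARGINALS of the parity-check box (`hmarg` of
`chenCheckBoxDigitObserver_le_centred`) — it characterises and, for instances in systematic form such as
Chen's, discharges from a hypothesis on the public matrix alone.  HONEST FRAMING: kernel-checked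
THEOREMS of elementary linear algebra over `ℤ_q` feeding a counting bound about the measurement
statistics of states occurring in a WITHDRAWN algorithm; NOT summit progress, no cryptanalytic claim in
either direction, no new algorithm.

## What is proved

**A. Residues and representatives** (`boxRed`, `boxRep`; pure bookkeeping).  Reduction `ℤ^m → ℤ_q^m`
and the canonical lift `ℤ_q^m → [0,q)^m` are inverse bijections between the box `intBox m q` and
`ℤ_q^m`; an additive check `κ : ℤ^m →+ ℤ_q` depends on its argument only through its residue
(`apply_eq_of_boxRed_eq`: two integer vectors with the same residues differ by `q`·(integer vector)),
so through the lift it is `ℤ_q`-linear on residues (`apply_boxRep_add`, `apply_boxRep_smul`).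

**B. The criterion** (`checkSol`, `checkBox_marginal_iff`).  For additive checks `κ_j : ℤ^m →+ ℤ_q`
the parity-check box `R = checkBox q κ` (T21) is in bijection with the solution module
`S = {v ∈ ℤ_q^m : κ_j(lift v) = 0 ∀ j}` (`card_checkBox_filter_eq`), and for every coordinate `i`:
the `i`-th marginal of the uniform law on `R` is uniform on `[0,q)` (`q · #{a ∈ R : a_i = x} = #R`
for all `x ∈ [0,q)`) **iff** some solution has `i`-th coordinate `1` (iff the coordinate projection
`S → ℤ_q` is onto).  "If": translating by `(y − x)•e` (`e ∈ S`, `e_i = 1`) injects the fibre over `x`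
into the fibre over `y`, so all `q` fibres of `S` are equinumerous (`card_checkSol_eq_mul`); "only if":
the fibre over the representative of `1` is non-empty.  Integer form: a vector `e ∈ ℤ^m` annihilated
by the checks with `e_i ≡ 1 (mod q)` suffices (`checkBox_marginals_of_witness`).

**C. Systematic form** (`freeCols`, `sysForm`, `sysCheck`, `sysExtend`, `sysCheckBox_marginals`,
`sysCheckBox_marginals_iff`).  Checks in SYSTEMATIC form — row `j` reads
`v_{τ j} + Σ_{k free} M_{jk} v_k` with an injective pivot map `τ` (an identity block on the pivot
columns; Chen's `I_m`) — have every FREE coordinate uniformly distributed on the box, unconditionally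
(the free coordinates parametrise the solutions: `sysExtend`), and the PIVOT coordinate `τ j` uniformly
distributed iff the free part of row `j` generates the unit ideal of `ℤ_q`
(`∃ c, Σ_{k free} c_k M_{jk} = 1`); so ALL marginals are uniform iff every row's free part generates
`ℤ_q` (`sysCheckBox_marginals_iff`) — implied by ONE unit entry in the free part of each row
(`row_generates_of_isUnit`), and for prime `q` equivalent to "the free part of each row is non-zero"
(`row_generates_iff_of_prime`).

**D. Chen's box** (`chenSysCheckBoxDigitObserver_le_centred`).  T21 (e)
(`chenCheckBoxDigitObserver_le_centred`) with its hypothesis `hmarg` DISCHARGED: for checks in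
systematic form whose rows generate `ℤ_q` on the free columns, `b` annihilated by the checks, every
digit observer of the Step-9 register (told the instance, the secret, `k′` and any translation-invariant
side information) reads the datum with probability at most `1/Q + Dp₁(Q² − 1)‖b‖₁/(2Qq)`.
Dictionary: this module's ambient `ℤ^{n+1}` is Chen's `ℤ^n`, `n = 1 + ℓ + m` (head, secret block,
error block); `ι` = the `m` sample/error indices; `τ j` = the position of error coordinate `j` (the
block `I_m` of `A`); free columns = head and secret block; `M_{j,0} = 2p₁t_j`, `M_{j,1+k} = U_{kj}`;
`hrow` holds for row `j` unless `(2p₁t_j, U_{1j}, …, U_{ℓj})` generates a proper ideal of `ℤ_q` — for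
prime `q`: unless it vanishes, i.e. for all but at most a `q^{−ℓ}` fraction of instances per row
(uniform `U`), the census's "every public row non-zero mod `q`" (§26.2 (iii), §30.3) made exact.

## What is NOT here

The identification of Chen's hidden-vector law with the uniform law on `L_q^⊥(A) ∩ [0,q)^n` (census
§24.3, Lemma A: a modelling fact about Steps 1–8, by hand); the size estimate `W → 0` at Chen's
parameters (census §26.2, by hand arithmetic from C.1–C.7); coherent (non-diagonal) instance-aware
measurements (row G7's residual); any cryptanalytic claim.
-/

namespace Literature.Computability.Cryptography.Chen2024

open scoped BigOperators

/-! ### A. Residues and canonical representatives -/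

section Residues

variable {m : ℕ} (q : ℕ)

/-- Coordinatewise reduction `ℤ^m → ℤ_q^m`. [folklore] -/
def boxRed (a : Fin m → ℤ) : Fin m → ZMod q := fun i => (a i : ZMod q)

/-- Coordinatewise canonical representative `ℤ_q^m → [0,q)^m ⊂ ℤ^m`. [folklore] -/
def boxRep (v : Fin m → ZMod q) : Fin m → ℤ := fun i => ((v i).val : ℤ)

/-- Reduction of the zero vector. [folklore] -/
theorem boxRed_zero : boxRed q (0 : Fin m → ℤ) = 0 := by
  funext i
  simp [boxRed]

/-- Reduction is additive. [folklore] -/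
theorem boxRed_add (a a' : Fin m → ℤ) : boxRed q (a + a') = boxRed q a + boxRed q a' := by
  funext i
  simp [boxRed]

/-- The canonical representative reduces back to the residue. [folklore] -/
theorem boxRed_boxRep [NeZero q] (v : Fin m → ZMod q) : boxRed q (boxRep q v) = v := by
  funext i
  simp only [boxRed, boxRep, Int.cast_natCast, ZMod.natCast_zmod_val]

/-- The canonical representative lies in the box `[0,q)^m`. [folklore] -/
theorem boxRep_mem_intBox [NeZero q] (v : Fin m → ZMod q) : boxRep q v ∈ intBox m q :=
  mem_intBox.2 fun i => Finset.mem_Ico.2 ⟨Int.natCast_nonneg _, Int.ofNat_lt.2 (ZMod.val_lt (v i))⟩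

/-- A point of the box is the canonical representative of its residue. [folklore] -/
theorem boxRep_boxRed [NeZero q] {a : Fin m → ℤ} (ha : a ∈ intBox m q) : boxRep q (boxRed q a) = a := by
  funext i
  obtain ⟨h0, h1⟩ := Finset.mem_Ico.1 (mem_intBox.1 ha i)
  simp only [boxRep, boxRed]
  rw [ZMod.val_intCast, Int.emod_eq_of_lt h0 h1]

/-- **An additive check into `ℤ_q` only sees residues**: integer vectors with equal residues differ by
`q` times an integer vector, which every additive map into `ℤ_q` kills. [folklore] -/
theorem apply_eq_of_boxRed_eq (κ : (Fin m → ℤ) →+ ZMod q) {a a' : Fin m → ℤ}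
    (h : boxRed q a = boxRed q a') : κ a = κ a' := by
  have hd : ∀ i, ∃ c : ℤ, a' i - a i = q * c := fun i => by
    have hi : (a i : ZMod q) = (a' i : ZMod q) := congr_fun h i
    exact (ZMod.intCast_eq_intCast_iff_dvd_sub (a i) (a' i) q).1 hi
  choose d hd using hd
  have ha' : a' = a + (q : ℤ) • d := by
    funext i
    have := hd i
    simp only [Pi.add_apply, Pi.smul_apply, smul_eq_mul]
    linarith
  rw [ha', map_add, map_zsmul, zsmul_eq_mul, Int.cast_natCast, ZMod.natCast_self, zero_mul, add_zero]

/-- Through the canonical lift an additive check is additive on residues. [folklore] -/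
theorem apply_boxRep_add [NeZero q] (κ : (Fin m → ℤ) →+ ZMod q) (v w : Fin m → ZMod q) :
    κ (boxRep q (v + w)) = κ (boxRep q v) + κ (boxRep q w) := by
  rw [← map_add]
  exact apply_eq_of_boxRed_eq q κ (by rw [boxRed_boxRep, boxRed_add, boxRed_boxRep, boxRed_boxRep])

/-- Through the canonical lift an additive check is `ℤ_q`-homogeneous on residues. [folklore] -/
theorem apply_boxRep_smul [NeZero q] (κ : (Fin m → ℤ) →+ ZMod q) (c : ZMod q) (v : Fin m → ZMod q) :
    κ (boxRep q (c • v)) = c * κ (boxRep q v) := by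
  have h : boxRed q (boxRep q (c • v)) = boxRed q (((c.val : ℕ) : ℤ) • boxRep q v) := by
    rw [boxRed_boxRep]
    funext i
    simp only [boxRed, boxRep, Pi.smul_apply, smul_eq_mul, Int.cast_mul, Int.cast_natCast,
      ZMod.natCast_zmod_val]
  rw [apply_eq_of_boxRed_eq q κ h, map_zsmul, zsmul_eq_mul, Int.cast_natCast, ZMod.natCast_zmod_val]

end Residues

/-! ### B. The solution module and the marginal criterion -/

section CheckSol

variable {m : ℕ} (q : ℕ) {ι : Type*} [Fintype ι] (κ : ι → ((Fin m → ℤ) →+ ZMod q))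

/-- The SOLUTION MODULE of the checks on residues: `{v ∈ ℤ_q^m : κ_j (lift v) = 0 ∀ j}` — Chen's
`L_q^⊥(A)/qℤ^n`. [cite: ChenQuantumLattice2024, §3.2 pp. 16–18] -/
noncomputable def checkSol [NeZero q] : Finset (Fin m → ZMod q) :=
  Finset.univ.filter fun v => ∀ j, κ j (boxRep q v) = 0

/-- Membership in the solution module. [folklore] -/
theorem mem_checkSol [NeZero q] {v : Fin m → ZMod q} : v ∈ checkSol q κ ↔ ∀ j, κ j (boxRep q v) = 0 := by
  rw [checkSol, Finset.mem_filter]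
  exact ⟨fun h => h.2, fun h => ⟨Finset.mem_univ _, h⟩⟩

/-- The residue of a point of the parity-check box is a solution. [folklore] -/
theorem boxRed_mem_checkSol [NeZero q] {a : Fin m → ℤ} (ha : a ∈ checkBox q κ) :
    boxRed q a ∈ checkSol q κ := by
  rw [mem_checkSol]
  intro j
  rw [boxRep_boxRed q (checkBox_subset_intBox q κ ha)]
  rw [checkBox, Finset.mem_filter] at ha
  exact ha.2 j

/-- The canonical representative of a solution is a point of the parity-check box. [folklore] -/
theorem boxRep_mem_checkBox [NeZero q] {v : Fin m → ZMod q} (hv : v ∈ checkSol q κ) :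
    boxRep q v ∈ checkBox q κ := by
  rw [checkBox, Finset.mem_filter]
  exact ⟨boxRep_mem_intBox q v, (mem_checkSol q κ).1 hv⟩

/-- The solution module is closed under `v ↦ v + c • e`. [folklore] -/
theorem checkSol_add_smul_mem [NeZero q] {e v : Fin m → ZMod q} (he : e ∈ checkSol q κ)
    (hv : v ∈ checkSol q κ) (c : ZMod q) : v + c • e ∈ checkSol q κ := by
  rw [mem_checkSol] at he hv ⊢
  intro j
  rw [apply_boxRep_add, apply_boxRep_smul, hv j, he j, mul_zero, add_zero]

/-- **Translation injects fibres into fibres.**  If a solution `e` has `e_i = 1`, then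
`v ↦ v + (y − x)•e` maps the solutions with `v_i = x` injectively into those with `v_i = y`.
[folklore] -/
theorem card_filter_checkSol_le [NeZero q] {e : Fin m → ZMod q} (he : e ∈ checkSol q κ) (i : Fin m)
    (hei : e i = 1) (x y : ZMod q) :
    ((checkSol q κ).filter fun v => v i = x).card ≤ ((checkSol q κ).filter fun v => v i = y).card := by
  refine Finset.card_le_card_of_injOn (fun v => v + (y - x) • e) (fun v hv => ?_)
    (fun v _ v' _ h => add_right_cancel h)
  simp only [Finset.coe_filter, Set.mem_setOf_eq] at hv ⊢
  refine ⟨checkSol_add_smul_mem q κ he hv.1 _, ?_⟩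
  rw [Pi.add_apply, Pi.smul_apply, hv.2, hei, smul_eq_mul, mul_one, add_sub_cancel]

/-- **Equinumerous fibres**: with a solution `e`, `e_i = 1`, every fibre of the `i`-th coordinate
projection of the solution module has `#S / q` elements. [folklore] -/
theorem card_checkSol_eq_mul [NeZero q] {e : Fin m → ZMod q} (he : e ∈ checkSol q κ) (i : Fin m)
    (hei : e i = 1) (x : ZMod q) :
    (checkSol q κ).card = q * ((checkSol q κ).filter fun v => v i = x).card := by
  have hmaps : Set.MapsTo (fun v : Fin m → ZMod q => v i) ↑(checkSol q κ)
      ↑(Finset.univ : Finset (ZMod q)) := fun v _ => Finset.mem_coe.2 (Finset.mem_univ _)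
  calc (checkSol q κ).card
      = ∑ y ∈ (Finset.univ : Finset (ZMod q)), ((checkSol q κ).filter fun v => v i = y).card :=
        Finset.card_eq_sum_card_fiberwise hmaps
    _ = ∑ y ∈ (Finset.univ : Finset (ZMod q)), ((checkSol q κ).filter fun v => v i = x).card :=
        Finset.sum_congr rfl fun y _ =>
          le_antisymm (card_filter_checkSol_le q κ he i hei y x) (card_filter_checkSol_le q κ he i hei x y)
    _ = q * ((checkSol q κ).filter fun v => v i = x).card := by
        rw [Finset.sum_const, Finset.card_univ, ZMod.card, smul_eq_mul]

/-- **Box ↔ solutions**: reduction/lift is a bijection between the part of the parity-check box cut out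
by a condition on residues and the corresponding part of the solution module. [folklore] -/
theorem card_checkBox_filter_eq [NeZero q] (p : (Fin m → ZMod q) → Prop) [DecidablePred p] :
    ((checkBox q κ).filter fun a => p (boxRed q a)).card = ((checkSol q κ).filter p).card := by
  refine Finset.card_nbij' (boxRed q) (boxRep q) (fun a ha => ?_) (fun v hv => ?_) (fun a ha => ?_)
    (fun v _ => boxRed_boxRep q v)
  · rw [Finset.mem_coe, Finset.mem_filter] at ha ⊢
    exact ⟨boxRed_mem_checkSol q κ ha.1, ha.2⟩
  · rw [Finset.mem_coe, Finset.mem_filter] at hv ⊢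
    refine ⟨boxRep_mem_checkBox q κ hv.1, ?_⟩
    rw [boxRed_boxRep]
    exact hv.2
  · exact boxRep_boxRed q (checkBox_subset_intBox q κ (Finset.mem_filter.1 (Finset.mem_coe.1 ha)).1)

/-- The parity-check box and the solution module are equinumerous. [folklore] -/
theorem card_checkBox_eq_card_checkSol [NeZero q] : (checkBox q κ).card = (checkSol q κ).card := by
  have h := card_checkBox_filter_eq q κ (fun _ => True)
  rw [Finset.filter_true_of_mem fun _ _ => trivial, Finset.filter_true_of_mem fun _ _ => trivial] at h
  exact h

/-- A coordinate fibre of the box over `x ∈ [0,q)` is the coordinate fibre of the solution module over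
the residue of `x`. [folklore] -/
theorem card_checkBox_filter_coord_eq [NeZero q] (i : Fin m) {x : ℤ} (hx : x ∈ Finset.Ico (0 : ℤ) q) :
    ((checkBox q κ).filter fun a => a i = x).card
      = ((checkSol q κ).filter fun v => v i = (x : ZMod q)).card := by
  rw [← card_checkBox_filter_eq q κ fun v => v i = (x : ZMod q)]
  refine congr_arg Finset.card (Finset.filter_congr fun a ha => ?_)
  obtain ⟨h0, h1⟩ := Finset.mem_Ico.1 (mem_intBox.1 (checkBox_subset_intBox q κ ha) i)
  obtain ⟨hx0, hx1⟩ := Finset.mem_Ico.1 hx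
  simp only [boxRed]
  constructor
  · intro h
    rw [h]
  · intro h
    have h' := congr_arg (fun z : ZMod q => (z.val : ℤ)) h
    simp only [ZMod.val_intCast] at h'
    rwa [Int.emod_eq_of_lt h0 h1, Int.emod_eq_of_lt hx0 hx1] at h'

/-- **Uniform marginal from a witness (residue form).**  If some solution has `i`-th coordinate `1`,
the `i`-th marginal of the uniform law on the parity-check box is uniform on `[0,q)` — the hypothesis
`hmarg` of T21's `chenCheckBoxDigitObserver_le_centred` for the coordinate `i`. [folklore] -/
theorem checkBox_marginals_of_mem_checkSol [NeZero q] {e : Fin m → ZMod q} (he : e ∈ checkSol q κ)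
    (i : Fin m) (hei : e i = 1) :
    ∀ x ∈ Finset.Ico (0 : ℤ) q,
      q * ((checkBox q κ).filter fun a => a i = x).card = (checkBox q κ).card := by
  intro x hx
  rw [card_checkBox_filter_coord_eq q κ i hx, card_checkBox_eq_card_checkSol q κ,
    ← card_checkSol_eq_mul q κ he i hei (x : ZMod q)]

/-- **Uniform marginal from a witness (integer form).**  An integer vector annihilated by the checks (a
vector of `L_q^⊥(A)`) with `i`-th coordinate `≡ 1 (mod q)` makes the `i`-th marginal uniform.
[folklore] -/
theorem checkBox_marginals_of_witness [NeZero q] (e : Fin m → ℤ) (he : ∀ j, κ j e = 0) (i : Fin m)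
    (hei : (e i : ZMod q) = 1) :
    ∀ x ∈ Finset.Ico (0 : ℤ) q,
      q * ((checkBox q κ).filter fun a => a i = x).card = (checkBox q κ).card :=
  checkBox_marginals_of_mem_checkSol q κ (e := boxRed q e)
    ((mem_checkSol q κ).2 fun j => by
      rw [apply_eq_of_boxRed_eq q (κ j) (boxRed_boxRep q (boxRed q e))]
      exact he j)
    i hei

/-- **Witness from a uniform marginal.**  Conversely, if the `i`-th marginal is uniform then some
solution has `i`-th coordinate `1` (the fibre over the representative of `1` is non-empty).
[folklore] -/
theorem exists_mem_checkSol_of_marginals [NeZero q] (i : Fin m)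
    (hmarg : ∀ x ∈ Finset.Ico (0 : ℤ) q,
      q * ((checkBox q κ).filter fun a => a i = x).card = (checkBox q κ).card) :
    ∃ v ∈ checkSol q κ, v i = 1 := by
  have hq : 0 < q := Nat.pos_of_ne_zero (NeZero.ne q)
  have hxI : (((1 : ZMod q).val : ℕ) : ℤ) ∈ Finset.Ico (0 : ℤ) q :=
    Finset.mem_Ico.2 ⟨Int.natCast_nonneg _, Int.ofNat_lt.2 (ZMod.val_lt (1 : ZMod q))⟩
  have hcard : 0 < ((checkBox q κ).filter fun a => a i = (((1 : ZMod q).val : ℕ) : ℤ)).card := by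
    have h := hmarg _ hxI
    have hpos : 0 < (checkBox q κ).card := (checkBox_nonempty q κ hq).card_pos
    rcases Nat.eq_zero_or_pos
        ((checkBox q κ).filter fun a => a i = (((1 : ZMod q).val : ℕ) : ℤ)).card with h0 | h0
    · rw [h0, mul_zero] at h
      omega
    · exact h0
  obtain ⟨a, ha⟩ := Finset.card_pos.1 hcard
  rw [Finset.mem_filter] at ha
  refine ⟨boxRed q a, boxRed_mem_checkSol q κ ha.1, ?_⟩
  show (a i : ZMod q) = 1
  rw [ha.2, Int.cast_natCast, ZMod.natCast_zmod_val]

/-- **The marginal criterion** (census §31): the `i`-th marginal of the uniform law on the parity-check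
box is uniform on `[0,q)` iff the `i`-th coordinate projection of the solution module
`L_q^⊥(A)/qℤ^n → ℤ_q` is onto (iff some solution has `i`-th coordinate `1`). [folklore] -/
theorem checkBox_marginal_iff [NeZero q] (i : Fin m) :
    (∀ x ∈ Finset.Ico (0 : ℤ) q,
        q * ((checkBox q κ).filter fun a => a i = x).card = (checkBox q κ).card)
      ↔ ∃ v ∈ checkSol q κ, v i = 1 :=
  ⟨exists_mem_checkSol_of_marginals q κ i,
    fun ⟨_, hv, hvi⟩ => checkBox_marginals_of_mem_checkSol q κ hv i hvi⟩

end CheckSol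

/-! ### C. Checks in systematic form -/

section Systematic

variable {m : ℕ} (q : ℕ) {ι : Type*} [Fintype ι] (τ : ι → Fin m) (M : ι → Fin m → ZMod q)

/-- The FREE (non-pivot) columns of a pivot map `τ`. [folklore] -/
def freeCols : Finset (Fin m) := Finset.univ.filter fun k => ∀ j, τ j ≠ k

/-- Membership in the free columns. [folklore] -/
theorem mem_freeCols {k : Fin m} : k ∈ freeCols τ ↔ ∀ j, τ j ≠ k := by
  rw [freeCols, Finset.mem_filter]
  exact ⟨fun h => h.2, fun h => ⟨Finset.mem_univ _, h⟩⟩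

/-- Row `j` of a system of checks in SYSTEMATIC form, on residues:
`v ↦ v_{τ j} + Σ_{k free} M_{jk} v_k` — Chen's row `j` of `A = [2p₁t | Uᵀ | I_m]`
(`τ j` = error coordinate `j`, `M_{j,·}` = `(2p₁t_j, U_{·j})` on head and secret block).
[cite: ChenQuantumLattice2024, §3.2 pp. 16–18; §3.3 p. 18] -/
def sysForm (j : ι) (v : Fin m → ZMod q) : ZMod q := v (τ j) + ∑ k ∈ freeCols τ, v k * M j k

/-- A systematic row vanishes on the zero vector. [folklore] -/
theorem sysForm_zero (j : ι) : sysForm q τ M j 0 = 0 := by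
  simp [sysForm]

/-- A systematic row is additive. [folklore] -/
theorem sysForm_add (j : ι) (v w : Fin m → ZMod q) :
    sysForm q τ M j (v + w) = sysForm q τ M j v + sysForm q τ M j w := by
  simp only [sysForm, Pi.add_apply, add_mul, Finset.sum_add_distrib]
  ring

/-- The checks of a systematic system as additive maps on integer vectors (`κ_j a = sysForm_j (a mod q)`),
the shape consumed by T21's `checkBox`. [cite: ChenQuantumLattice2024, §3.2 pp. 16–18] -/
def sysCheck (j : ι) : (Fin m → ℤ) →+ ZMod q where
  toFun a := sysForm q τ M j (boxRed q a)
  map_zero' := by simp only [boxRed_zero, sysForm_zero]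
  map_add' a a' := by simp only [boxRed_add, sysForm_add]

/-- Evaluation of a systematic check. [folklore] -/
@[simp] theorem sysCheck_apply (j : ι) (a : Fin m → ℤ) :
    sysCheck q τ M j a = sysForm q τ M j (boxRed q a) := rfl

/-- EXTENSION of free values to a solution: keep `c` on the free columns, solve for the pivots.
[folklore] -/
noncomputable def sysExtend (c : Fin m → ZMod q) : Fin m → ZMod q := fun k =>
  if h : ∃ j, τ j = k then -(∑ k' ∈ freeCols τ, c k' * M h.choose k') else c k

/-- The extension agrees with `c` on the free columns. [folklore] -/
theorem sysExtend_of_mem {c : Fin m → ZMod q} {k : Fin m} (hk : k ∈ freeCols τ) :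
    sysExtend q τ M c k = c k := by
  have h : ¬ ∃ j, τ j = k := fun ⟨j, hj⟩ => (mem_freeCols τ).1 hk j hj
  dsimp only [sysExtend]
  rw [dif_neg h]

/-- The extension on a pivot column (injective pivots). [folklore] -/
theorem sysExtend_pivot (hτ : Function.Injective τ) (c : Fin m → ZMod q) (j : ι) :
    sysExtend q τ M c (τ j) = -(∑ k ∈ freeCols τ, c k * M j k) := by
  dsimp only [sysExtend]
  split_ifs with h
  · have hj : h.choose = j := hτ h.choose_spec
    rw [hj]
  · exact absurd ⟨j, rfl⟩ h

/-- The extension solves every row. [folklore] -/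
theorem sysForm_sysExtend (hτ : Function.Injective τ) (c : Fin m → ZMod q) (j : ι) :
    sysForm q τ M j (sysExtend q τ M c) = 0 := by
  have hsum : ∑ k ∈ freeCols τ, sysExtend q τ M c k * M j k = ∑ k ∈ freeCols τ, c k * M j k :=
    Finset.sum_congr rfl fun k hk => by rw [sysExtend_of_mem q τ M hk]
  rw [sysForm, sysExtend_pivot q τ M hτ c j, hsum, neg_add_cancel]

/-- The extension is a solution of the systematic checks. [folklore] -/
theorem sysExtend_mem_checkSol [NeZero q] (hτ : Function.Injective τ) (c : Fin m → ZMod q) :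
    sysExtend q τ M c ∈ checkSol q (sysCheck q τ M) := by
  rw [mem_checkSol]
  intro j
  rw [sysCheck_apply, boxRed_boxRep]
  exact sysForm_sysExtend q τ M hτ c j

/-- **Free coordinates are uniform, unconditionally.** [folklore] -/
theorem sysCheckBox_marginals_free [NeZero q] (hτ : Function.Injective τ) {i : Fin m}
    (hi : i ∈ freeCols τ) :
    ∀ x ∈ Finset.Ico (0 : ℤ) q,
      q * ((checkBox q (sysCheck q τ M)).filter fun a => a i = x).card
        = (checkBox q (sysCheck q τ M)).card :=
  checkBox_marginals_of_mem_checkSol q (sysCheck q τ M)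
    (sysExtend_mem_checkSol q τ M hτ (Pi.single i 1)) i
    (by rw [sysExtend_of_mem q τ M hi, Pi.single_eq_same])

/-- **A pivot coordinate is uniform when the free part of its row generates `ℤ_q`.** [folklore] -/
theorem sysCheckBox_marginals_pivot [NeZero q] (hτ : Function.Injective τ) (j₀ : ι)
    (hrow : ∃ c : Fin m → ZMod q, ∑ k ∈ freeCols τ, c k * M j₀ k = 1) :
    ∀ x ∈ Finset.Ico (0 : ℤ) q,
      q * ((checkBox q (sysCheck q τ M)).filter fun a => a (τ j₀) = x).card
        = (checkBox q (sysCheck q τ M)).card := by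
  obtain ⟨c, hc⟩ := hrow
  refine checkBox_marginals_of_mem_checkSol q (sysCheck q τ M)
    (sysExtend_mem_checkSol q τ M hτ (-c)) (τ j₀) ?_
  rw [sysExtend_pivot q τ M hτ]
  simp only [Pi.neg_apply, neg_mul, Finset.sum_neg_distrib, neg_neg]
  exact hc

/-- **T23 — uniform marginals of a systematic parity-check box.**  If the free part of every row
generates the unit ideal of `ℤ_q`, EVERY coordinate of the uniform law on the parity-check box is
uniform on `[0,q)`: the hypothesis `hmarg` of T21 (e). [folklore] -/
theorem sysCheckBox_marginals [NeZero q] (hτ : Function.Injective τ)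
    (hrow : ∀ j, ∃ c : Fin m → ZMod q, ∑ k ∈ freeCols τ, c k * M j k = 1) (i : Fin m) :
    ∀ x ∈ Finset.Ico (0 : ℤ) q,
      q * ((checkBox q (sysCheck q τ M)).filter fun a => a i = x).card
        = (checkBox q (sysCheck q τ M)).card := by
  by_cases hi : i ∈ freeCols τ
  · exact sysCheckBox_marginals_free q τ M hτ hi
  · obtain ⟨j, hj⟩ : ∃ j, τ j = i := by
      by_contra h
      push Not at h
      exact hi ((mem_freeCols τ).2 h)
    subst hj
    exact sysCheckBox_marginals_pivot q τ M hτ j (hrow j)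

/-- **Necessity.**  If the pivot coordinate `τ j₀` is uniform, the free part of row `j₀` generates
`ℤ_q`. [folklore] -/
theorem row_generates_of_marginals [NeZero q] (j₀ : ι)
    (hmarg : ∀ x ∈ Finset.Ico (0 : ℤ) q,
      q * ((checkBox q (sysCheck q τ M)).filter fun a => a (τ j₀) = x).card
        = (checkBox q (sysCheck q τ M)).card) :
    ∃ c : Fin m → ZMod q, ∑ k ∈ freeCols τ, c k * M j₀ k = 1 := by
  obtain ⟨v, hv, hv1⟩ := exists_mem_checkSol_of_marginals q (sysCheck q τ M) (τ j₀) hmarg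
  have h0 : sysForm q τ M j₀ v = 0 := by
    have h := (mem_checkSol q (sysCheck q τ M)).1 hv j₀
    rwa [sysCheck_apply, boxRed_boxRep] at h
  rw [sysForm, hv1] at h0
  refine ⟨-v, ?_⟩
  simp only [Pi.neg_apply, neg_mul, Finset.sum_neg_distrib]
  linear_combination -h0

/-- **The systematic criterion**: all coordinate marginals of the parity-check box of a systematic
system are uniform iff the free part of every row generates the unit ideal of `ℤ_q`. [folklore] -/
theorem sysCheckBox_marginals_iff [NeZero q] (hτ : Function.Injective τ) :
    (∀ i, ∀ x ∈ Finset.Ico (0 : ℤ) q,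
        q * ((checkBox q (sysCheck q τ M)).filter fun a => a i = x).card
          = (checkBox q (sysCheck q τ M)).card)
      ↔ ∀ j, ∃ c : Fin m → ZMod q, ∑ k ∈ freeCols τ, c k * M j k = 1 :=
  ⟨fun h j => row_generates_of_marginals q τ M j (h (τ j)),
    fun h i => sysCheckBox_marginals q τ M hτ h i⟩

/-- ONE UNIT ENTRY in the free part of a row makes it generate `ℤ_q`. [folklore] -/
theorem row_generates_of_isUnit {j : ι} {k₀ : Fin m} (hk₀ : k₀ ∈ freeCols τ) (hu : IsUnit (M j k₀)) :
    ∃ c : Fin m → ZMod q, ∑ k ∈ freeCols τ, c k * M j k = 1 := by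
  obtain ⟨u, hu⟩ := hu
  refine ⟨Pi.single k₀ (↑u⁻¹ : ZMod q), ?_⟩
  rw [Finset.sum_eq_single_of_mem k₀ hk₀ fun k _ hk => by rw [Pi.single_eq_of_ne hk, zero_mul],
    Pi.single_eq_same, ← hu, Units.inv_mul]

/-- For PRIME `q` a row generates `ℤ_q` on the free columns iff its free part is non-zero — the
census's "public row non-zero mod `q`". [folklore] -/
theorem row_generates_iff_of_prime [Fact q.Prime] (j : ι) :
    (∃ c : Fin m → ZMod q, ∑ k ∈ freeCols τ, c k * M j k = 1) ↔ ∃ k ∈ freeCols τ, M j k ≠ 0 := by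
  constructor
  · rintro ⟨c, hc⟩
    by_contra h
    push Not at h
    rw [Finset.sum_eq_zero fun k hk => by rw [h k hk, mul_zero]] at hc
    exact zero_ne_one hc
  · rintro ⟨k, hk, hne⟩
    exact row_generates_of_isUnit q τ M hk (isUnit_iff_ne_zero.2 hne)

end Systematic

/-! ### D. Chen's parity-check box: T21 (e) with the marginal hypothesis discharged -/

section ChenSys

variable (n : ℕ) (D p₁ Q : ℕ+) (b : Fin (n + 1) → ℤ)

/-- **T23 (Chen form) — the box-wrap bound on a systematic parity-check box, no marginal hypothesis.**
Odd `P = p₁Q`, `b₀ = −1`, `2D²p₁` a unit mod `Q`; the instance in systematic form (injective pivots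
`τ` = Chen's identity block `I_m`, free part `M` = `[2p₁t | Uᵀ]`) whose every row generates `ℤ_q` on
the free columns (prime `q`: every row of `[2p₁t | Uᵀ]` non-zero — all instances but a `≤ q^{−ℓ}`
fraction per row); the secret `b` annihilated by the checks (`b ∈ L_q^⊥(A)`, eq. (12)); the hidden
vector `ν` uniform on the parity-check box `L_q^⊥(A) ∩ [0,q)^{n+1}`; offset `v′ = D·(w₀ − ν)`; side
information invariant under `ν ↦ ν − 2Dp₁t_k·b` on the box (centred `t_k`).  Then every digit observer
reads the datum with probability at most `1/Q + Dp₁(Q² − 1)‖b‖₁/(2Qq)`.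
[cite: ChenQuantumLattice2024, §3.5.9 pp. 35–37, §3.2 pp. 16–18, eq. (12) p. 17, §3.3 p. 18;
census §26.2, §31] -/
theorem chenSysCheckBoxDigitObserver_le_centred (hP : Odd ((p₁ * Q : ℕ+) : ℕ)) (hb : b 0 = -1)
    (hunit : IsUnit ((2 * D * D * p₁ : ℕ) : ZQ Q))
    {Sd ι : Type*} [Fintype Sd] [DecidableEq Sd] [Fintype ι]
    (q : ℕ) [NeZero q] (τ : ι → Fin (n + 1)) (hτ : Function.Injective τ)
    (M : ι → Fin (n + 1) → ZMod q)
    (hrow : ∀ j, ∃ c : Fin (n + 1) → ZMod q, ∑ k ∈ freeCols τ, c k * M j k = 1)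
    (hbκ : ∀ j, sysCheck q τ M j b = 0)
    (w₀ : Fin (n + 1) → ℤ) (f : (Fin (n + 1) → ℤ) → Sd)
    (hf : ∀ k, ∀ ν ∈ checkBox q (sysCheck q τ M),
      f (ν + hiddenShift n D p₁ Q b (fun k => k.valMinAbs) k) = f ν)
    (g : (Fin (n + 1) → ZN D p₁ Q) × Sd → ZQ Q → ℝ)
    (hg : ∀ o a', 0 ≤ g o a') (hg1 : ∀ o, ∑ a', g o a' = 1) :
    ((checkBox q (sysCheck q τ M)).card : ℝ)⁻¹
        * ∑ ν ∈ checkBox q (sysCheck q τ M), ∑ o, digitKernel n D p₁ Q b (chenOff n D w₀) f ν o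
          * g o (toDatum D p₁ Q ((chenOff n D w₀ ν 0 : ℤ) : ZN D p₁ Q))
      ≤ 1 / ((Q : ℕ) : ℝ) + ((D : ℕ) : ℝ) * ((p₁ : ℕ) : ℝ) * (((Q : ℕ) : ℝ) ^ 2 - 1)
          * (∑ i, ((b i).natAbs : ℝ)) / (2 * ((Q : ℕ) : ℝ) * q) :=
  chenCheckBoxDigitObserver_le_centred n D p₁ Q b hP hb hunit q (Nat.pos_of_ne_zero (NeZero.ne q))
    (sysCheck q τ M) hbκ (sysCheckBox_marginals q τ M hτ hrow) w₀ f hf g hg hg1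

end ChenSys

end Literature.Computability.Cryptography.Chen2024
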